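import Summits.HubbardSuperconductivity.HubbardSuperconductivity.Theorems.KacWindowPenaltyWindowGapTwistedPairField
import Mathlib.Data.Int.Interval

/-!
# Crux `WindowGap` (stmt-HubbardSuperconductivity-1088): the twist ceiling, I —
# the twisted window weights sum to `O(εL · L²)`

Third step of the TWIST CEILING of `Cruxes/WindowGap/NOTES.md` §3/§8 (bookkeeping half). For a
real form factor `f` with `|f| ≤ 1`, the Kac-window pair penalty
`W_ε = L⁻² Σ_{|q_m| ≤ ε} Δ_f(m)ᴴ Δ_f(m)` (`Δ_f(m) = pairFieldAt f L m`), `ε ≥ 0`, `4J < L` and a unit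
Fock vector `ψ`:

  `Σ_{|j| ≤ J} Re ⟨G_j ψ, W_ε G_j ψ⟩ ≤ 50 (2⌊εL/2π⌋ + 1) L²`      (`sum_twistedWindowWeight_le`),

`G_j` the Lieb–Schultz–Mattis twist of winding `j`. Ingredients: the weight of `G_jψ` at momentum
`m` is at most five times the single-bond weights of `ψ` at `m + 2jê₁`
(`re_star_pairFieldAt_mulVec_twist_le`, step 2); as `j` runs over `|j| ≤ J < L/4` each momentum is
covered by at most `2⌊εL/2π⌋ + 1` shifted windows (`card_filter_window_shift_le`: `j ↦ m'₀ − 2j` is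
injective and lands in `|valMinAbs| ≤ ⌊εL/2π⌋`); and the per-bond Parseval sum rule
`Σ_m ‖Δ_{f·1_e}(m)ψ‖² = L² Σ_x ‖P^{f·1_e}_x ψ‖² ≤ 2L⁴` (`sum_re_star_pairFieldAt_single_le`).
The ceiling itself and its consequence for the crux are in `…/Negative/TwistCeiling.lean`.

Support / negative for the crux (`--supports stmt-HubbardSuperconductivity-1088`); no definitions,
no named facts. T. Kennedy, E. H. Lieb, B. S. Shastry, PRL 61 (1988) 2582 (Parseval sum rule);
H. Watanabe, J. Stat. Phys. 177 (2019) 717, §2.2.1; D. J. Scalapino, Phys. Rep. 250 (1995) 329, §2.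
-/

-- the mandated namespace repeats `HubbardSuperconductivity` (single-problem summit, D-0017)
set_option linter.dupNamespace false

noncomputable section

namespace Summit.HubbardSuperconductivity.HubbardSuperconductivity.Theorems.WindowGap.Negative

open Matrix Finset Literature.MathematicalPhysics.QuantumLattice
  Literature.MathematicalPhysics.QuantumFieldTheory Literature.Probability.LatticeModels
  Summit.HubbardSuperconductivity.HubbardSuperconductivity.Theorems
open scoped ComplexConjugate

variable {L : ℕ} [NeZero L]

/-! ### Counting: each momentum lies in few shifted windows -/

/-- A momentum label in the window `|q_m| ≤ ε` has first coordinate `|valMinAbs m₀| ≤ ⌊εL/2π⌋`.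
[folklore] -/
theorem natAbs_valMinAbs_le_floor_of_window {ε : ℝ} (hε : 0 ≤ ε) {m : TorusSite 2 L}
    (hm : (2 * Real.pi / (L : ℝ)) ^ 2 * (∑ i : Fin 2, (((m i).valMinAbs : ℤ) : ℝ) ^ 2) ≤ ε ^ 2) :
    (m 0).valMinAbs.natAbs ≤ ⌊ε * L / (2 * Real.pi)⌋₊ := by
  have hL : (0 : ℝ) < L := Nat.cast_pos.2 (Nat.pos_of_ne_zero (NeZero.ne L))
  have hc : (0 : ℝ) < 2 * Real.pi / L := by positivity
  have h0 : (((m 0).valMinAbs : ℤ) : ℝ) ^ 2 ≤ ∑ i : Fin 2, (((m i).valMinAbs : ℤ) : ℝ) ^ 2 := by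
    rw [Fin.sum_univ_two]
    nlinarith [sq_nonneg (((m 1).valMinAbs : ℤ) : ℝ)]
  have h1 : (2 * Real.pi / L * |(((m 0).valMinAbs : ℤ) : ℝ)|) ^ 2 ≤ ε ^ 2 := by
    rw [mul_pow, sq_abs]
    exact (mul_le_mul_of_nonneg_left h0 (sq_nonneg _)).trans hm
  have h2 : 2 * Real.pi / L * |(((m 0).valMinAbs : ℤ) : ℝ)| ≤ ε :=
    le_of_pow_le_pow_left₀ two_ne_zero hε h1
  have h3 : |(((m 0).valMinAbs : ℤ) : ℝ)| ≤ ε * L / (2 * Real.pi) := by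
    rw [le_div_iff₀ (by positivity)]
    have h4 : 2 * Real.pi / L * |(((m 0).valMinAbs : ℤ) : ℝ)| * L ≤ ε * L :=
      mul_le_mul_of_nonneg_right h2 hL.le
    calc |(((m 0).valMinAbs : ℤ) : ℝ)| * (2 * Real.pi)
        = 2 * Real.pi / L * |(((m 0).valMinAbs : ℤ) : ℝ)| * L := by field_simp
      _ ≤ ε * L := h4
  refine Nat.le_floor ?_
  rw [Nat.cast_natAbs, Int.cast_abs]
  exact h3

/-- **Covering count.** Fix `ε ≥ 0`, `4J < L` and a momentum label `m'`. The number of integer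
windings `j ∈ [−J, J]` for which `m' − 2j ê₁` lies in the window `|q| ≤ ε` is at most
`2⌊εL/2π⌋ + 1`: `j ↦ valMinAbs (m'₀ − 2j)` is injective on `[−J, J]` (two such `j` differ by less
than `L/2`) and takes values in `[−⌊εL/2π⌋, ⌊εL/2π⌋]`. [folklore] -/
theorem card_filter_window_shift_le {ε : ℝ} (hε : 0 ≤ ε) {J : ℕ} (hJ : 4 * J < L)
    (m' : TorusSite 2 L) :
    ((Finset.Icc (-(J : ℤ)) J).filter (fun j : ℤ =>
        (2 * Real.pi / (L : ℝ)) ^ 2 *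
            (∑ i : Fin 2, ((((m' - (Pi.single 0 (((2 * j : ℤ)) : ZMod L) : TorusSite 2 L)) i).valMinAbs : ℤ) : ℝ) ^ 2) ≤
          ε ^ 2)).card ≤
      2 * ⌊ε * L / (2 * Real.pi)⌋₊ + 1 := by
  have himage : ∀ j ∈ (Finset.Icc (-(J : ℤ)) J).filter (fun j : ℤ =>
      (2 * Real.pi / (L : ℝ)) ^ 2 *
          (∑ i : Fin 2, ((((m' - (Pi.single 0 (((2 * j : ℤ)) : ZMod L) : TorusSite 2 L)) i).valMinAbs : ℤ) : ℝ) ^ 2) ≤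
        ε ^ 2),
      ((m' - (Pi.single 0 (((2 * j : ℤ)) : ZMod L) : TorusSite 2 L)) 0).valMinAbs ∈ Finset.Icc (-(⌊ε * L / (2 * Real.pi)⌋₊ : ℤ)) ⌊ε * L / (2 * Real.pi)⌋₊ := by
    intro j hj
    have hw := (Finset.mem_filter.1 hj).2
    have hn := natAbs_valMinAbs_le_floor_of_window hε hw
    have habs : |((m' - (Pi.single 0 (((2 * j : ℤ)) : ZMod L) : TorusSite 2 L)) 0).valMinAbs| ≤
        ((⌊ε * L / (2 * Real.pi)⌋₊ : ℕ) : ℤ) := by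
      rw [Int.abs_eq_natAbs]
      exact_mod_cast hn
    exact Finset.mem_Icc.2 (abs_le.1 habs)
  have hinj : Set.InjOn (fun j : ℤ => ((m' - (Pi.single 0 (((2 * j : ℤ)) : ZMod L) : TorusSite 2 L)) 0).valMinAbs)
      ((Finset.Icc (-(J : ℤ)) J).filter (fun j : ℤ =>
        (2 * Real.pi / (L : ℝ)) ^ 2 *
            (∑ i : Fin 2, ((((m' - (Pi.single 0 (((2 * j : ℤ)) : ZMod L) : TorusSite 2 L)) i).valMinAbs : ℤ) : ℝ) ^ 2) ≤
          ε ^ 2) : Set ℤ) := by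
    intro j hj j' hj' h
    have hjI := Finset.mem_Icc.1 (Finset.mem_filter.1 hj).1
    have hj'I := Finset.mem_Icc.1 (Finset.mem_filter.1 hj').1
    have h' : (m' - (Pi.single 0 (((2 * j : ℤ)) : ZMod L) : TorusSite 2 L)) 0 =
        (m' - (Pi.single 0 (((2 * j' : ℤ)) : ZMod L) : TorusSite 2 L)) 0 := ZMod.injective_valMinAbs h
    simp only [Pi.sub_apply, Pi.single_eq_same] at h'
    rw [sub_right_inj] at h'
    rw [ZMod.intCast_eq_intCast_iff_dvd_sub] at h'
    have hzero : 2 * j' - 2 * j = 0 := by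
      refine Int.eq_zero_of_abs_lt_dvd h' ?_
      rw [abs_lt]
      constructor <;> omega
    omega
  calc ((Finset.Icc (-(J : ℤ)) J).filter _).card
      ≤ (Finset.Icc (-(⌊ε * L / (2 * Real.pi)⌋₊ : ℤ)) ⌊ε * L / (2 * Real.pi)⌋₊).card :=
        Finset.card_le_card_of_injOn _ himage hinj
    _ = 2 * ⌊ε * L / (2 * Real.pi)⌋₊ + 1 := by
        rw [Int.card_Icc]
        omega

/-- **Summing a nonnegative function over all shifted windows.** For `ε ≥ 0`, `4J < L` and
`F ≥ 0` on momentum labels,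
`Σ_{|j| ≤ J} Σ_{m ∈ window} F(m + 2jê₁) ≤ (2⌊εL/2π⌋ + 1) · Σ_m F(m)` (reindex each inner sum by the
shift, exchange, and count with `card_filter_window_shift_le`). [folklore] -/
theorem sum_Icc_sum_window_shift_le {ε : ℝ} (hε : 0 ≤ ε) {J : ℕ} (hJ : 4 * J < L)
    (F : TorusSite 2 L → ℝ) (hF : ∀ m, 0 ≤ F m) :
    ∑ j ∈ Finset.Icc (-(J : ℤ)) J, ∑ m : TorusSite 2 L,
        (if (2 * Real.pi / (L : ℝ)) ^ 2 * (∑ i : Fin 2, (((m i).valMinAbs : ℤ) : ℝ) ^ 2) ≤ ε ^ 2 then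
          F (m + Pi.single 0 (((2 * j : ℤ)) : ZMod L)) else 0) ≤
      (2 * ⌊ε * L / (2 * Real.pi)⌋₊ + 1 : ℕ) * ∑ m : TorusSite 2 L, F m := by
  have hre : ∀ j : ℤ, (∑ m : TorusSite 2 L,
      (if (2 * Real.pi / (L : ℝ)) ^ 2 * (∑ i : Fin 2, (((m i).valMinAbs : ℤ) : ℝ) ^ 2) ≤ ε ^ 2 then
        F (m + Pi.single 0 (((2 * j : ℤ)) : ZMod L)) else 0)) =
      ∑ m' : TorusSite 2 L,
        (if (2 * Real.pi / (L : ℝ)) ^ 2 *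
              (∑ i : Fin 2, ((((m' - (Pi.single 0 (((2 * j : ℤ)) : ZMod L) : TorusSite 2 L)) i).valMinAbs : ℤ) : ℝ) ^ 2) ≤
            ε ^ 2 then F m' else 0) := by
    intro j
    refine Fintype.sum_equiv (Equiv.addRight (Pi.single 0 (((2 * j : ℤ)) : ZMod L))) _ _ fun m => ?_
    simp only [Equiv.coe_addRight, add_sub_cancel_right]
  simp_rw [hre]
  rw [Finset.sum_comm, Finset.mul_sum]
  refine Finset.sum_le_sum fun m' _ => ?_
  rw [← Finset.sum_filter, Finset.sum_const, nsmul_eq_mul]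
  exact mul_le_mul_of_nonneg_right (by exact_mod_cast card_filter_window_shift_le hε hJ m') (hF m')

/-! ### The window weight, a general form factor -/

/-- Expectation of the Kac-window pair penalty built on the form factor `f`:
`Re ⟨φ, W_ε φ⟩ = Σ_{|q_m| ≤ ε} ‖Δ_f(m) φ‖² / L²`. (The route's `re_dotProduct_kacWindow_mulVec` is
the case `f = dWaveFormFactor`.) Scalapino, Phys. Rep. 250 (1995) 329, §2. [folklore] -/
theorem re_dotProduct_window_mulVec (f : Site 2 → ℝ) (ε : ℝ) (φ : Fock (Orb (FermionTorus 2 L))) :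
    (star φ ⬝ᵥ (∑ m : Fin 2 → ZMod L,
        if (2 * Real.pi / (L : ℝ)) ^ 2 * (∑ i : Fin 2, (((m i).valMinAbs : ℤ) : ℝ) ^ 2) ≤ ε ^ 2 then
          ((L : ℂ) ^ 2)⁻¹ • (Matrix.conjTranspose (pairFieldAt f L m) * pairFieldAt f L m)
        else 0) *ᵥ φ).re =
      ∑ m : Fin 2 → ZMod L,
        if (2 * Real.pi / (L : ℝ)) ^ 2 * (∑ i : Fin 2, (((m i).valMinAbs : ℤ) : ℝ) ^ 2) ≤ ε ^ 2 then
          (star (pairFieldAt f L m *ᵥ φ) ⬝ᵥ (pairFieldAt f L m *ᵥ φ)).re / (L : ℝ) ^ 2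
        else 0 := by
  have hc : ((((L : ℝ) ^ 2)⁻¹ : ℝ) : ℂ) = ((L : ℂ) ^ 2)⁻¹ := by
    rw [Complex.ofReal_inv, Complex.ofReal_pow, Complex.ofReal_natCast]
  rw [sum_mulVec, dotProduct_sum, Complex.re_sum]
  refine Finset.sum_congr rfl fun m _ => ?_
  split_ifs with hm
  · rw [smul_mulVec, dotProduct_smul, smul_eq_mul, ← Literature.MathematicalPhysics.QuantumLattice.star_mulVec_dotProduct_mulVec, ← hc,
      Complex.re_ofReal_mul, div_eq_inv_mul]
  · rw [zero_mulVec, dotProduct_zero, Complex.zero_re]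

/-- **Per-bond Parseval ceiling.** For a unit Fock vector `ψ`, a form factor with `|f e| ≤ 1` and a
bond type `e`: `Σ_m ‖Δ_{f·1_e}(m) ψ‖² ≤ 2 L⁴` (pair sum rule `Σ_m ‖Δ_g(m)ψ‖² = L² Σ_x ‖P^g_x ψ‖²`,
`sum_star_pairFieldAt_mulVec_dotProduct`, and `‖P^{f·1_e}_x ψ‖ ≤ √2 |f e|`,
`norm_toLp_localPair_mulVec_le`). Kennedy–Lieb–Shastry, PRL 61 (1988) 2582. [folklore] -/
theorem sum_re_star_pairFieldAt_single_le (f : Site 2 → ℝ) (hf : ∀ e, |f e| ≤ 1) (e : Site 2)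
    {ψ : Fock (Orb (FermionTorus 2 L))} (hψ : star ψ ⬝ᵥ ψ = 1) :
    ∑ m : TorusSite 2 L,
        (star (pairFieldAt (Pi.single e (f e)) L m *ᵥ ψ) ⬝ᵥ (pairFieldAt (Pi.single e (f e)) L m *ᵥ ψ)).re ≤
      2 * (L : ℝ) ^ 4 := by
  have hsum := congrArg Complex.re (sum_star_pairFieldAt_mulVec_dotProduct (Pi.single e (f e)) L ψ)
  rw [Complex.re_sum, show ((L : ℂ) ^ 2) = (((L : ℝ) ^ 2 : ℝ) : ℂ) by push_cast; rfl,
    Complex.re_ofReal_mul, Complex.re_sum] at hsum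
  rw [hsum]
  -- the single-bond constant: `C = Σ_{e'} 2 |f·1_e (e')| / √2 ≤ √2`
  have hC : (∑ e' ∈ insert (0 : Site 2) unitSteps,
      ‖(((Pi.single e (f e) : Site 2 → ℝ) e' / Real.sqrt 2 : ℝ) : ℂ)‖ * 2) ≤ Real.sqrt 2 := by
    have hterm : ∀ e' ∈ insert (0 : Site 2) unitSteps,
        ‖(((Pi.single e (f e) : Site 2 → ℝ) e' / Real.sqrt 2 : ℝ) : ℂ)‖ * 2 ≤
          if e' = e then Real.sqrt 2 else 0 := by
      intro e' _
      by_cases h : e' = e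
      · rw [if_pos h, h, Pi.single_eq_same, Complex.norm_real, Real.norm_eq_abs, abs_div,
          abs_of_pos (Real.sqrt_pos.2 two_pos)]
        have h2 : (0 : ℝ) < Real.sqrt 2 := Real.sqrt_pos.2 two_pos
        rw [div_mul_eq_mul_div, div_le_iff₀ h2]
        nlinarith [hf e, Real.sq_sqrt zero_le_two, abs_nonneg (f e)]
      · rw [if_neg h, Pi.single_eq_of_ne h, zero_div, Complex.ofReal_zero, norm_zero, zero_mul]
    refine (Finset.sum_le_sum hterm).trans ?_
    rw [Finset.sum_ite_eq']
    split_ifs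
    · exact le_rfl
    · exact (Real.sqrt_pos.2 two_pos).le
  have hC0 := localPairNormBound_nonneg (Pi.single e (f e))
  have hsite : ∀ x : TorusSite 2 L,
      (star (localPair (Pi.single e (f e)) L x *ᵥ ψ) ⬝ᵥ (localPair (Pi.single e (f e)) L x *ᵥ ψ)).re ≤ 2 := by
    intro x
    rw [← norm_toLp_sq_eq_re]
    have h := norm_toLp_localPair_mulVec_le (Pi.single e (f e)) L x ψ
    have hψ1 : ‖(WithLp.toLp 2 ψ : EuclideanSpace ℂ (Finset (Orb (FermionTorus 2 L))))‖ = 1 := by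
      rw [← pow_eq_one_iff_of_nonneg (norm_nonneg _) two_ne_zero, norm_toLp_sq_eq_re, hψ,
        Complex.one_re]
    rw [hψ1, mul_one] at h
    calc ‖(WithLp.toLp 2 (localPair (Pi.single e (f e)) L x *ᵥ ψ) :
            EuclideanSpace ℂ (Finset (Orb (FermionTorus 2 L))))‖ ^ 2
        ≤ (Real.sqrt 2) ^ 2 := pow_le_pow_left₀ (norm_nonneg _) (h.trans hC) 2
      _ = 2 := Real.sq_sqrt zero_le_two
  have hcard : (Finset.univ : Finset (TorusSite 2 L)).card = L ^ 2 := by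
    rw [Finset.card_univ]; simp [ZMod.card]
  calc (L : ℝ) ^ 2 * ∑ x : TorusSite 2 L,
        (star (localPair (Pi.single e (f e)) L x *ᵥ ψ) ⬝ᵥ (localPair (Pi.single e (f e)) L x *ᵥ ψ)).re
      ≤ (L : ℝ) ^ 2 * ∑ _x : TorusSite 2 L, (2 : ℝ) := by
        gcongr with x _
        exact hsite x
    _ = 2 * (L : ℝ) ^ 4 := by
        rw [Finset.sum_const, hcard, nsmul_eq_mul]
        push_cast
        ring

/-! ### Summing the twisted window weights over the windings -/

/-- **The twisted window weights sum to `O(εL · L²)`.** For `ε ≥ 0`, `4J < L`, a form factor with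
`|f| ≤ 1` and a unit Fock vector `ψ`:
`Σ_{|j| ≤ J} Re ⟨G_j ψ, W_ε G_j ψ⟩ ≤ 50 (2⌊εL/2π⌋ + 1) L²`, `G_j` the Lieb–Schultz–Mattis twist of
winding `j` (`re_star_pairFieldAt_mulVec_twist_le`: the weight of `G_jψ` at `m` is at most five times
the single-bond weights of `ψ` at `m + 2jê₁`; `sum_Icc_sum_window_shift_le`: each momentum is covered
by at most `2⌊εL/2π⌋ + 1` shifted windows; `sum_re_star_pairFieldAt_single_le`: per-bond Parseval).
[folklore] -/
theorem sum_twistedWindowWeight_le (f : Site 2 → ℝ) (hf : ∀ e, |f e| ≤ 1) {ε : ℝ} (hε : 0 ≤ ε)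
    {J : ℕ} (hJ : 4 * J < L) {ψ : Fock (Orb (FermionTorus 2 L))} (hψ : star ψ ⬝ᵥ ψ = 1) :
    ∑ j ∈ Finset.Icc (-(J : ℤ)) J,
        (star (phaseGauge (fun u : FermionTorus 2 L => twistGauge L (j * (2 * Real.pi)) u.toTorusSite) *ᵥ ψ) ⬝ᵥ
          ((∑ m : Fin 2 → ZMod L,
              if (2 * Real.pi / (L : ℝ)) ^ 2 * (∑ i : Fin 2, (((m i).valMinAbs : ℤ) : ℝ) ^ 2) ≤ ε ^ 2 then
                ((L : ℂ) ^ 2)⁻¹ • (Matrix.conjTranspose (pairFieldAt f L m) * pairFieldAt f L m)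
              else 0) *ᵥ
            (phaseGauge (fun u : FermionTorus 2 L => twistGauge L (j * (2 * Real.pi)) u.toTorusSite) *ᵥ ψ))).re ≤
      50 * (2 * ⌊ε * L / (2 * Real.pi)⌋₊ + 1 : ℕ) * (L : ℝ) ^ 2 := by
  have hL : (0 : ℝ) < L := Nat.cast_pos.2 (Nat.pos_of_ne_zero (NeZero.ne L))
  have hL2 : (0 : ℝ) < (L : ℝ) ^ 2 := by positivity
  -- step 1: expand each weight over the window and bound mode by mode by the shifted bond weights
  have hstep : ∀ j : ℤ,
      (star (phaseGauge (fun u : FermionTorus 2 L => twistGauge L (j * (2 * Real.pi)) u.toTorusSite) *ᵥ ψ) ⬝ᵥ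
          ((∑ m : Fin 2 → ZMod L,
              if (2 * Real.pi / (L : ℝ)) ^ 2 * (∑ i : Fin 2, (((m i).valMinAbs : ℤ) : ℝ) ^ 2) ≤ ε ^ 2 then
                ((L : ℂ) ^ 2)⁻¹ • (Matrix.conjTranspose (pairFieldAt f L m) * pairFieldAt f L m)
              else 0) *ᵥ
            (phaseGauge (fun u : FermionTorus 2 L => twistGauge L (j * (2 * Real.pi)) u.toTorusSite) *ᵥ ψ))).re ≤
        ∑ m : TorusSite 2 L,
          (if (2 * Real.pi / (L : ℝ)) ^ 2 * (∑ i : Fin 2, (((m i).valMinAbs : ℤ) : ℝ) ^ 2) ≤ ε ^ 2 then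
            (5 * ∑ e ∈ insert (0 : Site 2) unitSteps,
              (star (pairFieldAt (Pi.single e (f e)) L (m + Pi.single 0 (((2 * j : ℤ)) : ZMod L)) *ᵥ ψ) ⬝ᵥ
                (pairFieldAt (Pi.single e (f e)) L (m + Pi.single 0 (((2 * j : ℤ)) : ZMod L)) *ᵥ ψ)).re) /
              (L : ℝ) ^ 2
          else 0) := by
    intro j
    rw [re_dotProduct_window_mulVec]
    refine Finset.sum_le_sum fun m _ => ?_
    split_ifs
    · exact div_le_div_of_nonneg_right (re_star_pairFieldAt_mulVec_twist_le f j m ψ) hL2.le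
    · exact le_rfl
  refine (Finset.sum_le_sum fun j _ => hstep j).trans ?_
  -- step 2: pull the constant factors out and exchange the bond sum with the (j, m) sums
  have hrw : ∀ j : ℤ, (∑ m : TorusSite 2 L,
      (if (2 * Real.pi / (L : ℝ)) ^ 2 * (∑ i : Fin 2, (((m i).valMinAbs : ℤ) : ℝ) ^ 2) ≤ ε ^ 2 then
        (5 * ∑ e ∈ insert (0 : Site 2) unitSteps,
          (star (pairFieldAt (Pi.single e (f e)) L (m + Pi.single 0 (((2 * j : ℤ)) : ZMod L)) *ᵥ ψ) ⬝ᵥ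
            (pairFieldAt (Pi.single e (f e)) L (m + Pi.single 0 (((2 * j : ℤ)) : ZMod L)) *ᵥ ψ)).re) /
          (L : ℝ) ^ 2
      else 0)) =
      5 / (L : ℝ) ^ 2 * ∑ e ∈ insert (0 : Site 2) unitSteps, ∑ m : TorusSite 2 L,
        (if (2 * Real.pi / (L : ℝ)) ^ 2 * (∑ i : Fin 2, (((m i).valMinAbs : ℤ) : ℝ) ^ 2) ≤ ε ^ 2 then
          (star (pairFieldAt (Pi.single e (f e)) L (m + Pi.single 0 (((2 * j : ℤ)) : ZMod L)) *ᵥ ψ) ⬝ᵥ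
            (pairFieldAt (Pi.single e (f e)) L (m + Pi.single 0 (((2 * j : ℤ)) : ZMod L)) *ᵥ ψ)).re
        else 0) := by
    intro j
    rw [Finset.sum_comm, Finset.mul_sum]
    refine Finset.sum_congr rfl fun m _ => ?_
    split_ifs
    · rw [Finset.mul_sum, Finset.mul_sum, Finset.sum_div]
      refine Finset.sum_congr rfl fun e _ => ?_
      ring
    · rw [Finset.sum_const_zero, mul_zero]
  simp_rw [hrw]
  rw [← Finset.mul_sum, Finset.sum_comm]
  -- step 3: count the covering and apply per-bond Parseval
  have hbond : ∀ e ∈ insert (0 : Site 2) unitSteps,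
      ∑ j ∈ Finset.Icc (-(J : ℤ)) J, ∑ m : TorusSite 2 L,
        (if (2 * Real.pi / (L : ℝ)) ^ 2 * (∑ i : Fin 2, (((m i).valMinAbs : ℤ) : ℝ) ^ 2) ≤ ε ^ 2 then
          (star (pairFieldAt (Pi.single e (f e)) L (m + Pi.single 0 (((2 * j : ℤ)) : ZMod L)) *ᵥ ψ) ⬝ᵥ
            (pairFieldAt (Pi.single e (f e)) L (m + Pi.single 0 (((2 * j : ℤ)) : ZMod L)) *ᵥ ψ)).re
        else 0) ≤
      (2 * ⌊ε * L / (2 * Real.pi)⌋₊ + 1 : ℕ) * (2 * (L : ℝ) ^ 4) := by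
    intro e _
    refine (sum_Icc_sum_window_shift_le hε hJ
      (fun m => (star (pairFieldAt (Pi.single e (f e)) L m *ᵥ ψ) ⬝ᵥ
        (pairFieldAt (Pi.single e (f e)) L m *ᵥ ψ)).re)
      (fun m => by rw [← norm_toLp_sq_eq_re]; positivity)).trans ?_
    exact mul_le_mul_of_nonneg_left (sum_re_star_pairFieldAt_single_le f hf e hψ) (Nat.cast_nonneg _)
  have h5 : ((insert (0 : Site 2) unitSteps).card : ℝ) ≤ 5 := by
    exact_mod_cast twAhm_card_steps_le
  have hR0 : (0 : ℝ) ≤ (2 * ⌊ε * L / (2 * Real.pi)⌋₊ + 1 : ℕ) := Nat.cast_nonneg _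
  calc 5 / (L : ℝ) ^ 2 * ∑ e ∈ insert (0 : Site 2) unitSteps, ∑ j ∈ Finset.Icc (-(J : ℤ)) J,
        ∑ m : TorusSite 2 L,
          (if (2 * Real.pi / (L : ℝ)) ^ 2 * (∑ i : Fin 2, (((m i).valMinAbs : ℤ) : ℝ) ^ 2) ≤ ε ^ 2 then
            (star (pairFieldAt (Pi.single e (f e)) L (m + Pi.single 0 (((2 * j : ℤ)) : ZMod L)) *ᵥ ψ) ⬝ᵥ
              (pairFieldAt (Pi.single e (f e)) L (m + Pi.single 0 (((2 * j : ℤ)) : ZMod L)) *ᵥ ψ)).re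
          else 0)
      ≤ 5 / (L : ℝ) ^ 2 * ∑ _e ∈ insert (0 : Site 2) unitSteps,
          ((2 * ⌊ε * L / (2 * Real.pi)⌋₊ + 1 : ℕ) * (2 * (L : ℝ) ^ 4)) := by
        gcongr with e he
        exact hbond e he
    _ = 5 / (L : ℝ) ^ 2 * ((insert (0 : Site 2) unitSteps).card *
          ((2 * ⌊ε * L / (2 * Real.pi)⌋₊ + 1 : ℕ) * (2 * (L : ℝ) ^ 4))) := by
        rw [Finset.sum_const, nsmul_eq_mul]
    _ ≤ 5 / (L : ℝ) ^ 2 * (5 * ((2 * ⌊ε * L / (2 * Real.pi)⌋₊ + 1 : ℕ) * (2 * (L : ℝ) ^ 4))) := by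
        gcongr
    _ = 50 * (2 * ⌊ε * L / (2 * Real.pi)⌋₊ + 1 : ℕ) * (L : ℝ) ^ 2 := by
        field_simp
        ring


end Summit.HubbardSuperconductivity.HubbardSuperconductivity.Theorems.WindowGap.Negative
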